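import Literature.RepresentationTheory.HeisenbergGroup.SchwartzBruhatQuadricSupport
import Mathlib.LinearAlgebra.QuadraticForm.Basic
import HarnessLib

/-!
# An INTEGRAL uncertainty principle on `𝒮(K^{ι₁})` ∕ `𝒮(K^{ι₁} × K^{ι₂})`: box support + Fourier-side quadratic-phase
# eigenvectors + a lattice non-constancy hypothesis force `f = 0`

Topic `RepresentationTheory/HeisenbergGroup`; namespace `Literature.RepresentationTheory.HeisenbergGroup`.  KERNEL ONLY:
theorems; no definition, no named fact, no record, no `sorry`.  Pure non-archimedean analysis over the tree's Schwartz–Bruhat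
spaces (`SchwartzBruhat (ι → K)`), the boxes `(𝔭^N)^ι` (`piPrimePowBall`), the Fourier automorphism `piFourierEquivSB μ₁ hψ hm`
(`LocalPiSchwartzBruhatFourier`) and the coordinate splitting `e : ι₁ ⊕ ι₂ ≃ ι` with the product operators
`sumEndSB K e B₁ B₂ = B₁ ⊠ B₂` (`LocalSchwartzBruhatDirectSum`).  Companion of the FUNCTIONAL (distribution) version
`SchwartzBruhatQuadricSupport` ∕ `SchwartzBruhatQuadricUncertainty` (row IV-4(c1) of the cell): here the unknown is a
FUNCTION `f`, the second-degree characters `ψ(b·Q₂)` range only over INTEGRAL `b ∈ 𝒪 = 𝔭⁰`, and the contradiction comes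
from a LATTICE hypothesis (H) instead of anisotropy.  `ψ` has conductor exponent `m` throughout (`ψ|_{𝔭^m} = 1 ≠ ψ|_{𝔭^{m−1}}`);
the consumer's case is `m = 0`.

* §1 `eq_zero_of_periodic_of_addChar_mul_eigen` — THE CORE (pure algebra, no Schwartz–Bruhat space): a function `g` on any
  set `Y` fibred over `K^{ι₁}` by `R : Y → K^{ι₁}` with translations `τ_π` (`R (τ_π y) = R y + π`) which is (P) invariant under
  `τ_π` for `π` in a box `(𝔭^p)^{ι₁}`, (E) an eigenvector of every multiplication by `ψ(b · Q₂ (R y))`, `b ∈ 𝒪` (eigenvalue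
  arbitrary), and (H) `Q₂` is nowhere `𝔭^m`-constant along that box (`∀ η₀ ∃ π ∈ (𝔭^p)^{ι₁}, Q₂(η₀ + π) − Q₂(η₀) ∉ 𝔭^m`),
  VANISHES: at a point with `g ≠ 0` the eigenvalue is read off at `η₀` and at `η₀ + π`, so `ψ(b·(Q₂(η₀+π) − Q₂ η₀)) = 1` for all
  `b ∈ 𝒪`, i.e. the difference lies in `𝔭^m` (conductor duality `exists_mem_primePowBall_addChar_mul_ne_one`) — against (H).
* §2 `eq_zero_of_support_subset_box_of_fourier_mulChar_eigen` (and `…_fourier_symm_…`) — on `𝒮(K^{ι₁})`: (S) `supp f ⊆ (𝔭^a)^{ι₁}`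
  makes `𝓕 f` (and `𝓕⁻¹ f`) `(𝔭^{m−a})^{ι₁}`-periodic (`piFourierSB_add_eq_of_support`), so §1 with (E) on the Fourier side
  and (H) along `(𝔭^{m−a})^{ι₁}` gives `𝓕 f = 0`, hence `f = 0`.
* §3 the SLICE formula `coe_sumEndSB_id_apply_glue`: `((B ⊠ 1) f)(a ⊔ b) = (B f(· ⊔ b))(a)` for ANY linear `B` on `𝒮(K^{ι₁})`
  (both sides are linear in `f` and agree on products `f₁ ⊠ f₂`; `linearMap_ext_boxSB`), with `sliceL_mem_schwartzBruhat`;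
  hence §4 `eq_zero_of_resL_support_subset_box_of_partialFourier_mulChar_eigen` (and `…_symm_…`) — the same principle on
  `𝒮(K^ι)`, `ι = ι₁ ⊔ ι₂`, for the PARTIAL Fourier transform `𝓕_{x′} ⊠ 1 = sumEndSB K e (piFourierEquivSB μ₁ hψ hm) id`,
  hypotheses (S), (E) read on the `ι₁`-coordinates `resL e`.
* §5 the SUPPORT FEEDER `forall_mem_primePowBall_of_mulChar_eigen_of_stable`: if `f` is an eigenvector of every
  multiplication by `ψ(b·Q₁ y)`, `b ∈ 𝒪`, and its support is stable under a map `φ` with `Q₁ ∘ φ = ν·Q₁`, `|ν − 1| = 1`, then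
  `Q₁ y ∈ 𝔭^m` on the support (two support points have `𝔭^m`-congruent `Q₁`-values; `(ν − 1) Q₁ y ∈ 𝔭^m` with `ν − 1` a unit).
* §6 the LATTICE HYPOTHESIS (H) for `Q₂ = c · N`, `N` a quadratic map with a unit value on `𝒪^{ι₁}`, `|c| = q^n`, `|2| = 1`
  and `n + 2a = m + 1` (`exists_mem_piPrimePowBall_quadraticMap_add_sub_notMem`): by the parallelogram law the instances `π`
  and `−π` of `𝔭^m`-constancy add up to `2 c N(π) ∈ 𝔭^m`, false at `π = ϖ^{a−m} e₀` — no anisotropy needed.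

Consumer: cell `hodgecm-mathlib`, crux H413 (stmt-HodgeConjecture-24833), P2 road δ (F0P2-p01 (g4) spec
`ROAD-DELTA-spec`, (CORE′) `eq_zero_of_forall_implementer_eigen_of_odd`: no non-zero common eigenvector of the implementers of
the hyperspecial `U(J)(𝒪_v)` in the Schrödinger model of an ODD unitary line) — δ2 supplies the integral hyperbolic pair, the
Darboux mover and the second-degree characters; this file is its splitting-free analytic half.  Folklore p-adic analysis
([WeilBNT1967, Chap. II §5 Prop. 12, Chap. VII §2 Prop. 2]; [MoeglinVignerasWaldspurger1987, Chap. 2 II.6–II.8] for the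
lattice-model heuristics); nothing of the cited sources is asserted.  HC_CM is proved only modulo the 7 printed citations until
rung 0 closes; this file proves nothing about them.

## References
* [WeilBNT1967] A. Weil, *Basic Number Theory* (1967), Chap. II §5 Prop. 12 (dual boxes), Chap. VII §2 Prop. 2 (standard functions).
* [MoeglinVignerasWaldspurger1987] C. Mœglin, M.-F. Vignéras, J.-L. Waldspurger, LNM 1291 (1987), Chap. 2 II.6–II.8.
* [Bruhat1961] F. Bruhat, *Distributions sur un groupe localement compact*, Bull. SMF 89 (1961), §9.
-/

set_option autoImplicit false

open MeasureTheory
open Literature.NumberTheory.Automorphic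
open Literature.NumberTheory.GaloisRepresentations.IsNonarchimedeanLocalField

namespace Literature.RepresentationTheory.HeisenbergGroup

/-! ## §1 The core: box-periodic quadratic-phase eigenvectors vanish under the lattice hypothesis -/

section Core

variable {K : Type*} [Field K] [ValuativeRel K] [TopologicalSpace K] [IsNonarchimedeanLocalField K]
  {ψ : AddChar K Circle} {m : ℤ}

/-- two values of `ψ(b·)` agree for every `b ∈ 𝒪` only if the arguments are congruent modulo `𝔭^m` (`m` = conductor exponent).
[cite: WeilBNT1967, Chap. II §5, Prop. 12] -/
theorem sub_mem_primePowBall_of_forall_addChar_mul_eq (hm : ψ.HasConductorExp m) {s t : K}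
    (h : ∀ b ∈ primePowBall K 0, ψ (b * s) = ψ (b * t)) : s - t ∈ primePowBall K m := by
  by_contra hst
  have hst' : s - t ∉ primePowBall K (m - 0) := by rwa [sub_zero]
  obtain ⟨b, hb, hne⟩ := exists_mem_primePowBall_addChar_mul_ne_one hm hst'
  exact hne (by rw [mul_sub, AddChar.map_sub_eq_div, h b hb, div_self'])

/-- **THE CORE (integral uncertainty, algebraic form).**  `Y` any set over `K^{ι₁}` (`R`, translations `τ_π` with
`R (τ_π y) = R y + π`); `g : Y → ℂ` (P) `τ_π`-invariant for `π ∈ (𝔭^p)^{ι₁}`, (E) an eigenvector of every multiplication by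
`ψ(b · Q₂ (R y))`, `b ∈ 𝒪` (any eigenvalue), (H) `∀ η₀ ∃ π ∈ (𝔭^p)^{ι₁}, Q₂(η₀ + π) − Q₂ η₀ ∉ 𝔭^m` ⟹ `g = 0`.
[cite: MoeglinVignerasWaldspurger1987, Chap. 2 II.6] -/
theorem eq_zero_of_periodic_of_addChar_mul_eigen (hm : ψ.HasConductorExp m) {Y : Type*} {ι₁ : Type*}
    (R : Y → (ι₁ → K)) (τ : (ι₁ → K) → Y → Y) (hRτ : ∀ π y, R (τ π y) = R y + π)
    (g : Y → ℂ) (Q₂ : (ι₁ → K) → K) {p : ℤ}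
    (hP : ∀ y, ∀ π ∈ piPrimePowBall K ι₁ p, g (τ π y) = g y)
    (hE : ∀ b ∈ primePowBall K 0, ∃ l : ℂ, ∀ y, ((ψ (b * Q₂ (R y)) : Circle) : ℂ) * g y = l * g y)
    (hH : ∀ η₀ : ι₁ → K, ∃ π ∈ piPrimePowBall K ι₁ p, Q₂ (η₀ + π) - Q₂ η₀ ∉ primePowBall K m) :
    g = 0 := by
  funext y₀
  rw [Pi.zero_apply]
  by_contra hg
  obtain ⟨π, hπ, hnot⟩ := hH (R y₀)
  refine hnot (sub_mem_primePowBall_of_forall_addChar_mul_eq hm fun b hb => ?_)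
  obtain ⟨l, hl⟩ := hE b hb
  have h1 := hl y₀
  have h2 := hl (τ π y₀)
  rw [hP y₀ π hπ, hRτ] at h2
  exact Circle.ext ((mul_right_cancel₀ hg h2).trans (mul_right_cancel₀ hg h1).symm)

/-! ## §5 (placed early: same algebra) The support feeder -/

/-- **SUPPORT FEEDER.**  If `f : Y → ℂ` is an eigenvector of every multiplication by `ψ(b · Q₁ y)`, `b ∈ 𝒪`, then `Q₁` is
`𝔭^m`-constant on the support of `f`. [cite: MoeglinVignerasWaldspurger1987, Chap. 2 II.6] -/
theorem sub_mem_primePowBall_of_mulChar_eigen (hm : ψ.HasConductorExp m) {Y : Type*} (f : Y → ℂ) (Q₁ : Y → K)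
    (hE : ∀ b ∈ primePowBall K 0, ∃ l : ℂ, ∀ y, ((ψ (b * Q₁ y) : Circle) : ℂ) * f y = l * f y)
    {y y' : Y} (hy : f y ≠ 0) (hy' : f y' ≠ 0) : Q₁ y - Q₁ y' ∈ primePowBall K m := by
  refine sub_mem_primePowBall_of_forall_addChar_mul_eq hm fun b hb => ?_
  obtain ⟨l, hl⟩ := hE b hb
  exact Circle.ext ((mul_right_cancel₀ hy (hl y)).trans (mul_right_cancel₀ hy' (hl y')).symm)

/-- **SUPPORT FEEDER, dilation form.**  If moreover the support of `f` is stable under a map `φ` rescaling `Q₁` by `ν` with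
`ν − 1` a UNIT, then `Q₁ y ∈ 𝔭^m` at every support point (`(ν − 1)·Q₁ y ∈ 𝔭^m`).  The consumer adds «`Q₁ x′ ∈ 𝔭^m ⇒ x′` in a
box» (coercivity ∕ integrality of the form) to get the support hypothesis (S) of §2∕§4.
[cite: MoeglinVignerasWaldspurger1987, Chap. 2 II.6] -/
theorem forall_mem_primePowBall_of_mulChar_eigen_of_stable (hm : ψ.HasConductorExp m) {Y : Type*} (f : Y → ℂ)
    (Q₁ : Y → K) (hE : ∀ b ∈ primePowBall K 0, ∃ l : ℂ, ∀ y, ((ψ (b * Q₁ y) : Circle) : ℂ) * f y = l * f y)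
    (φ : Y → Y) (hφ : ∀ y, f y ≠ 0 → f (φ y) ≠ 0) {ν : K} (hQφ : ∀ y, Q₁ (φ y) = ν * Q₁ y)
    (hν : normAbs K (ν - 1) = 1) (y : Y) (hy : f y ≠ 0) : Q₁ y ∈ primePowBall K m := by
  have h := sub_mem_primePowBall_of_mulChar_eigen hm f Q₁ hE (hφ y hy) hy
  rw [hQφ, ← sub_one_mul] at h
  have hν' : normAbs K (ν - 1) = (residueFieldCard K : NNReal)⁻¹ ^ (0 : ℤ) := by rw [zpow_zero, hν]
  rw [mul_mem_primePowBall_iff hν', sub_zero] at h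
  exact h

end Core

/-! ## §2 On `𝒮(K^{ι₁})`: box support, Fourier-side eigenvectors -/

section Fourier

variable {K : Type*} [Field K] [ValuativeRel K] [TopologicalSpace K] [IsNonarchimedeanLocalField K]
  {ι₁ : Type*} [Fintype ι₁] [MeasurableSpace (ι₁ → K)] [BorelSpace (ι₁ → K)] (μ₁ : Measure (ι₁ → K)) [μ₁.IsAddHaarMeasure]
  {ψ : AddChar K Circle} (hψ : ψ.IsContinuousNontrivial) {m : ℤ} (hm : ψ.HasConductorExp m)

omit [BorelSpace (ι₁ → K)] [μ₁.IsAddHaarMeasure] in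
include hm in
/-- support in `(𝔭^a)^{ι₁}` ⇒ the Fourier transform is `(𝔭^{m−a})^{ι₁}`-periodic. [cite: WeilBNT1967, Chap. VII §2, Prop. 2] -/
theorem piFourierSB_add_eq_of_support_subset {a : ℤ} {f : (ι₁ → K) → ℂ}
    (hS : ∀ x, f x ≠ 0 → x ∈ piPrimePowBall K ι₁ a) (η : ι₁ → K) {π : ι₁ → K} (hπ : π ∈ piPrimePowBall K ι₁ (m - a)) :
    piFourierSB ψ μ₁ f (η + π) = piFourierSB ψ μ₁ f η :=
  piFourierSB_add_eq_of_support ψ μ₁ hm (fun x hx => Classical.by_contradiction fun h => hx (hS x h)) η hπ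

/-- **INTEGRAL UNCERTAINTY on `𝒮(K^{ι₁})`, Fourier orientation.**  (S) `supp f ⊆ (𝔭^a)^{ι₁}`; (E) `𝓕 f` is an eigenvector of
every multiplication by `ψ(b·Q₂)`, `b ∈ 𝒪`; (H) `Q₂` is nowhere `𝔭^m`-constant along `(𝔭^{m−a})^{ι₁}` ⟹ `f = 0`.
[cite: MoeglinVignerasWaldspurger1987, Chap. 2 II.6–II.8] [cite: WeilBNT1967, Chap. VII §2, Prop. 2] -/
theorem eq_zero_of_support_subset_box_of_fourier_mulChar_eigen (Q₂ : (ι₁ → K) → K) {a : ℤ}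
    (f : SchwartzBruhat (ι₁ → K)) (hS : ∀ x, (f : (ι₁ → K) → ℂ) x ≠ 0 → x ∈ piPrimePowBall K ι₁ a)
    (hE : ∀ b ∈ primePowBall K 0, ∃ l : ℂ, ∀ η,
      ((ψ (b * Q₂ η) : Circle) : ℂ) * (piFourierEquivSB μ₁ hψ hm f : (ι₁ → K) → ℂ) η =
        l * (piFourierEquivSB μ₁ hψ hm f : (ι₁ → K) → ℂ) η)
    (hH : ∀ η₀ : ι₁ → K, ∃ π ∈ piPrimePowBall K ι₁ (m - a), Q₂ (η₀ + π) - Q₂ η₀ ∉ primePowBall K m) :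
    f = 0 := by
  have hg : ((piFourierEquivSB μ₁ hψ hm f : SchwartzBruhat (ι₁ → K)) : (ι₁ → K) → ℂ) = 0 := by
    refine eq_zero_of_periodic_of_addChar_mul_eigen hm id (fun π η => η + π) (fun _ _ => rfl) _ Q₂
      (fun η π hπ => ?_) hE hH
    rw [coe_piFourierEquivSB]
    exact piFourierSB_add_eq_of_support_subset μ₁ hm hS η hπ
  have h0 : piFourierEquivSB μ₁ hψ hm f = 0 := Subtype.ext hg
  exact (LinearEquiv.map_eq_zero_iff _).1 h0

/-- **INTEGRAL UNCERTAINTY on `𝒮(K^{ι₁})`, inverse-Fourier orientation** (`𝓕⁻¹ f = c⁻¹ · 𝓕f(−·)` is periodic as well).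
[cite: MoeglinVignerasWaldspurger1987, Chap. 2 II.6–II.8] [cite: WeilBNT1967, Chap. VII §2, Prop. 2] -/
theorem eq_zero_of_support_subset_box_of_fourier_symm_mulChar_eigen (Q₂ : (ι₁ → K) → K) {a : ℤ}
    (f : SchwartzBruhat (ι₁ → K)) (hS : ∀ x, (f : (ι₁ → K) → ℂ) x ≠ 0 → x ∈ piPrimePowBall K ι₁ a)
    (hE : ∀ b ∈ primePowBall K 0, ∃ l : ℂ, ∀ η,
      ((ψ (b * Q₂ η) : Circle) : ℂ) * ((piFourierEquivSB μ₁ hψ hm).symm f : (ι₁ → K) → ℂ) η =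
        l * ((piFourierEquivSB μ₁ hψ hm).symm f : (ι₁ → K) → ℂ) η)
    (hH : ∀ η₀ : ι₁ → K, ∃ π ∈ piPrimePowBall K ι₁ (m - a), Q₂ (η₀ + π) - Q₂ η₀ ∉ primePowBall K m) :
    f = 0 := by
  have hg : (((piFourierEquivSB μ₁ hψ hm).symm f : SchwartzBruhat (ι₁ → K)) : (ι₁ → K) → ℂ) = 0 := by
    refine eq_zero_of_periodic_of_addChar_mul_eigen hm id (fun π η => η + π) (fun _ _ => rfl) _ Q₂
      (fun η π hπ => ?_) hE hH
    rw [coe_piFourierEquivSB_symm]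
    simp only [neg_add]
    rw [piFourierSB_add_eq_of_support_subset μ₁ hm hS (-η) (neg_mem_piPrimePowBall hπ)]
  have h0 : (piFourierEquivSB μ₁ hψ hm).symm f = 0 := Subtype.ext hg
  exact (LinearEquiv.map_eq_zero_iff _).1 h0

end Fourier

/-! ## §3 The slice formula for `B ⊠ 1` -/

section Slice

variable {K : Type*} [Field K] [ValuativeRel K] [TopologicalSpace K] [IsNonarchimedeanLocalField K]
  {ι₁ ι₂ ι : Type*} [Fintype ι₁] [Fintype ι₂] [Fintype ι] (e : ι₁ ⊕ ι₂ ≃ ι)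

omit [Field K] [ValuativeRel K] [IsNonarchimedeanLocalField K] [Fintype ι₁] [Fintype ι₂] [Fintype ι] in
/-- a slice `x′ ↦ f(x′ ⊔ b)` of a Schwartz–Bruhat function on `K^ι` is Schwartz–Bruhat on `K^{ι₁}`.
[cite: WeilBNT1967, Chap. VII §2, Def. 1] -/
theorem sliceL_mem_schwartzBruhat {f : (ι → K) → ℂ} (hf : f ∈ SchwartzBruhat (ι → K)) (b : ι₂ → K) :
    (fun x' : ι₁ → K => f (glue e x' b)) ∈ SchwartzBruhat (ι₁ → K) := by
  have hc : Continuous fun x' : ι₁ → K => glue e x' b :=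
    (continuous_glue e).comp (continuous_id.prodMk continuous_const)
  refine ⟨hf.1.comp_continuous hc, ?_⟩
  set S : Set (ι₁ → K) := (fun x' : ι₁ → K => glue e x' b) ⁻¹' tsupport f with hS
  have hSc : IsClosed S := (isClosed_tsupport f).preimage hc
  have hSsub : S ⊆ resL e '' tsupport f := fun u hu => ⟨glue e u b, hu, resL_glue e u b⟩
  have hScpt : IsCompact S := (hf.2.isCompact.image (continuous_resL (X := K) e)).of_isClosed_subset hSc hSsub
  refine HasCompactSupport.intro' hScpt hSc fun u hu => ?_
  by_contra h
  exact hu (subset_tsupport _ h)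

/-- **THE SLICE FORMULA**: `((B ⊠ 1) f)(a ⊔ b) = (B (x′ ↦ f(x′ ⊔ b)))(a)` for every linear endomorphism `B` of `𝒮(K^{ι₁})` —
both sides are linear in `f` and agree on products `f₁ ⊠ f₂` (`(B f₁)(a) · f₂(b)`).
[cite: MoeglinVignerasWaldspurger1987, Chap. 2 II.1 Rem. (6)] -/
theorem coe_sumEndSB_id_apply_glue (B : SchwartzBruhat (ι₁ → K) →ₗ[ℂ] SchwartzBruhat (ι₁ → K))
    (f : SchwartzBruhat (ι → K)) (a : ι₁ → K) (b : ι₂ → K) :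
    ((sumEndSB K e B LinearMap.id f : SchwartzBruhat (ι → K)) : (ι → K) → ℂ) (glue e a b) =
      ((B ⟨fun x' => (f : (ι → K) → ℂ) (glue e x' b), sliceL_mem_schwartzBruhat e f.2 b⟩ : SchwartzBruhat (ι₁ → K)) :
        (ι₁ → K) → ℂ) a := by
  -- both sides as linear functionals of `f`
  let L₁ : SchwartzBruhat (ι → K) →ₗ[ℂ] ℂ :=
    { toFun := fun f => ((sumEndSB K e B LinearMap.id f : SchwartzBruhat (ι → K)) : (ι → K) → ℂ) (glue e a b)
      map_add' := fun f g => by simp only [map_add, Submodule.coe_add, Pi.add_apply]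
      map_smul' := fun c f => by simp only [map_smul, Submodule.coe_smul, Pi.smul_apply, RingHom.id_apply] }
  let sl : SchwartzBruhat (ι → K) →ₗ[ℂ] SchwartzBruhat (ι₁ → K) :=
    { toFun := fun f => ⟨fun x' => (f : (ι → K) → ℂ) (glue e x' b), sliceL_mem_schwartzBruhat e f.2 b⟩
      map_add' := fun f g => Subtype.ext (funext fun x' => by simp)
      map_smul' := fun c f => Subtype.ext (funext fun x' => by simp) }
  let L₂ : SchwartzBruhat (ι → K) →ₗ[ℂ] ℂ :=
    { toFun := fun f => ((B (sl f) : SchwartzBruhat (ι₁ → K)) : (ι₁ → K) → ℂ) a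
      map_add' := fun f g => by simp only [map_add, Submodule.coe_add, Pi.add_apply]
      map_smul' := fun c f => by simp only [map_smul, Submodule.coe_smul, Pi.smul_apply, RingHom.id_apply] }
  have hL : L₁ = L₂ := by
    refine linearMap_ext_boxSB K e fun f₁ f₂ => ?_
    have hsl : sl (boxSB K e f₁ f₂) = ((f₂ : (ι₂ → K) → ℂ) b) • f₁ :=
      Subtype.ext (funext fun x' => by
        simp only [sl, LinearMap.coe_mk, AddHom.coe_mk, boxSB_apply_glue, Submodule.coe_smul, Pi.smul_apply, smul_eq_mul,
          mul_comm])
    simp only [L₁, L₂, LinearMap.coe_mk, AddHom.coe_mk, sumEndSB_boxSB, LinearMap.id_coe, id_eq, boxSB_apply_glue, hsl,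
      map_smul, Submodule.coe_smul, Pi.smul_apply, smul_eq_mul, mul_comm]
  exact LinearMap.congr_fun hL f

end Slice

/-! ## §4 On `𝒮(K^ι)`, `ι = ι₁ ⊔ ι₂`: `ι₁`-box support, partial-Fourier-side eigenvectors -/

section PartialFourier

variable {K : Type*} [Field K] [ValuativeRel K] [TopologicalSpace K] [IsNonarchimedeanLocalField K]
  {ι₁ ι₂ ι : Type*} [Fintype ι₁] [Fintype ι₂] [Fintype ι] (e : ι₁ ⊕ ι₂ ≃ ι)
  [MeasurableSpace (ι₁ → K)] [BorelSpace (ι₁ → K)] (μ₁ : Measure (ι₁ → K)) [μ₁.IsAddHaarMeasure]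
  {ψ : AddChar K Circle} (hψ : ψ.IsContinuousNontrivial) {m : ℤ} (hm : ψ.HasConductorExp m)

omit [ValuativeRel K] [TopologicalSpace K] [IsNonarchimedeanLocalField K] [Fintype ι₁] [Fintype ι₂] [Fintype ι]
  [MeasurableSpace (ι₁ → K)] [BorelSpace (ι₁ → K)] [μ₁.IsAddHaarMeasure] in
/-- translation by `π ⊔ 0` moves only the `ι₁`-coordinates. [cite: WeilBNT1967, Chap. VII §2, Def. 1] -/
theorem resL_add_glue_zero (π : ι₁ → K) (y : ι → K) : resL e (y + glue e π 0) = resL e y + π := by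
  rw [resL_add, resL_glue]

omit [MeasurableSpace (ι₁ → K)] [BorelSpace (ι₁ → K)] [μ₁.IsAddHaarMeasure] in
/-- `ι₁`-support in `(𝔭^a)^{ι₁}` ⇒ `(B ⊠ 1) f` is `(𝔭^p)^{ι₁} ⊔ 0`-periodic whenever `B` maps functions supported in
`(𝔭^a)^{ι₁}` to `(𝔭^p)^{ι₁}`-periodic ones (slice by slice). [cite: WeilBNT1967, Chap. VII §2, Prop. 2] -/
theorem coe_sumEndSB_id_add_glue_eq (B : SchwartzBruhat (ι₁ → K) →ₗ[ℂ] SchwartzBruhat (ι₁ → K)) {a p : ℤ}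
    (hB : ∀ f₁ : SchwartzBruhat (ι₁ → K), (∀ x, (f₁ : (ι₁ → K) → ℂ) x ≠ 0 → x ∈ piPrimePowBall K ι₁ a) →
      ∀ η, ∀ π ∈ piPrimePowBall K ι₁ p, ((B f₁ : SchwartzBruhat (ι₁ → K)) : (ι₁ → K) → ℂ) (η + π) =
        ((B f₁ : SchwartzBruhat (ι₁ → K)) : (ι₁ → K) → ℂ) η)
    (f : SchwartzBruhat (ι → K)) (hS : ∀ x, (f : (ι → K) → ℂ) x ≠ 0 → resL e x ∈ piPrimePowBall K ι₁ a)
    (y : ι → K) {π : ι₁ → K} (hπ : π ∈ piPrimePowBall K ι₁ p) :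
    ((sumEndSB K e B LinearMap.id f : SchwartzBruhat (ι → K)) : (ι → K) → ℂ) (y + glue e π 0) =
      ((sumEndSB K e B LinearMap.id f : SchwartzBruhat (ι → K)) : (ι → K) → ℂ) y := by
  have hy : y + glue e π 0 = glue e (resL e y + π) (resR e y) := by
    conv_lhs => rw [← glue_resL_resR e y]
    rw [glue_add, add_zero]
  rw [hy]
  conv_rhs => rw [← glue_resL_resR e y]
  rw [coe_sumEndSB_id_apply_glue, coe_sumEndSB_id_apply_glue]
  exact hB _ (fun x' hx' => by simpa only [resL_glue] using hS _ hx') _ _ hπ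

/-- **INTEGRAL UNCERTAINTY on `𝒮(K^{ι₁} × K^{ι₂})`, partial-Fourier orientation** (`ℱ = 𝓕_{x′} ⊠ 1`): (S) the `ι₁`-support of
`f` lies in `(𝔭^a)^{ι₁}`; (E) `ℱ f` is an eigenvector of every multiplication by `ψ(b·Q₂(x′))`, `b ∈ 𝒪`; (H) `Q₂` is nowhere
`𝔭^m`-constant along `(𝔭^{m−a})^{ι₁}` ⟹ `f = 0`. [cite: MoeglinVignerasWaldspurger1987, Chap. 2 II.6–II.8]
[cite: WeilBNT1967, Chap. VII §2, Prop. 2] -/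
theorem eq_zero_of_resL_support_subset_box_of_partialFourier_mulChar_eigen (Q₂ : (ι₁ → K) → K) {a : ℤ}
    (f : SchwartzBruhat (ι → K)) (hS : ∀ x, (f : (ι → K) → ℂ) x ≠ 0 → resL e x ∈ piPrimePowBall K ι₁ a)
    (hE : ∀ b ∈ primePowBall K 0, ∃ l : ℂ, ∀ y,
      ((ψ (b * Q₂ (resL e y)) : Circle) : ℂ) *
          (sumEndSB K e (piFourierEquivSB μ₁ hψ hm).toLinearMap LinearMap.id f : (ι → K) → ℂ) y =
        l * (sumEndSB K e (piFourierEquivSB μ₁ hψ hm).toLinearMap LinearMap.id f : (ι → K) → ℂ) y)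
    (hH : ∀ η₀ : ι₁ → K, ∃ π ∈ piPrimePowBall K ι₁ (m - a), Q₂ (η₀ + π) - Q₂ η₀ ∉ primePowBall K m) :
    f = 0 := by
  set ℱ := sumEndSB K e (piFourierEquivSB μ₁ hψ hm).toLinearMap LinearMap.id with hℱ
  have hg : ((ℱ f : SchwartzBruhat (ι → K)) : (ι → K) → ℂ) = 0 := by
    refine eq_zero_of_periodic_of_addChar_mul_eigen hm (resL e) (fun π y => y + glue e π 0) (resL_add_glue_zero e) _ Q₂
      (fun y π hπ => ?_) hE hH
    refine coe_sumEndSB_id_add_glue_eq e _ (fun f₁ hf₁ η π' hπ' => ?_) f hS y hπ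
    rw [LinearEquiv.coe_coe, coe_piFourierEquivSB]
    exact piFourierSB_add_eq_of_support_subset μ₁ hm hf₁ η hπ'
  have h0 : ℱ f = 0 := Subtype.ext hg
  -- `ℱ` is injective: `(𝓕⁻¹ ⊠ 1) ∘ (𝓕 ⊠ 1) = 1`
  have hinv : sumEndSB K e (piFourierEquivSB μ₁ hψ hm).symm.toLinearMap LinearMap.id ∘ₗ ℱ = LinearMap.id := by
    rw [hℱ, ← sumEndSB_comp, ← sumEndSB_id K e]
    congr 1
    exact LinearMap.ext fun x => (piFourierEquivSB μ₁ hψ hm).symm_apply_apply x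
  have := LinearMap.congr_fun hinv f
  rw [LinearMap.comp_apply, h0, map_zero, LinearMap.id_apply] at this
  exact this.symm

/-- **INTEGRAL UNCERTAINTY on `𝒮(K^{ι₁} × K^{ι₂})`, inverse-partial-Fourier orientation** (`ℱ⁻¹ = 𝓕_{x′}⁻¹ ⊠ 1`).
[cite: MoeglinVignerasWaldspurger1987, Chap. 2 II.6–II.8] [cite: WeilBNT1967, Chap. VII §2, Prop. 2] -/
theorem eq_zero_of_resL_support_subset_box_of_partialFourier_symm_mulChar_eigen (Q₂ : (ι₁ → K) → K) {a : ℤ}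
    (f : SchwartzBruhat (ι → K)) (hS : ∀ x, (f : (ι → K) → ℂ) x ≠ 0 → resL e x ∈ piPrimePowBall K ι₁ a)
    (hE : ∀ b ∈ primePowBall K 0, ∃ l : ℂ, ∀ y,
      ((ψ (b * Q₂ (resL e y)) : Circle) : ℂ) *
          (sumEndSB K e (piFourierEquivSB μ₁ hψ hm).symm.toLinearMap LinearMap.id f : (ι → K) → ℂ) y =
        l * (sumEndSB K e (piFourierEquivSB μ₁ hψ hm).symm.toLinearMap LinearMap.id f : (ι → K) → ℂ) y)
    (hH : ∀ η₀ : ι₁ → K, ∃ π ∈ piPrimePowBall K ι₁ (m - a), Q₂ (η₀ + π) - Q₂ η₀ ∉ primePowBall K m) :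
    f = 0 := by
  set ℱ := sumEndSB K e (piFourierEquivSB μ₁ hψ hm).symm.toLinearMap LinearMap.id with hℱ
  have hg : ((ℱ f : SchwartzBruhat (ι → K)) : (ι → K) → ℂ) = 0 := by
    refine eq_zero_of_periodic_of_addChar_mul_eigen hm (resL e) (fun π y => y + glue e π 0) (resL_add_glue_zero e) _ Q₂
      (fun y π hπ => ?_) hE hH
    refine coe_sumEndSB_id_add_glue_eq e _ (fun f₁ hf₁ η π' hπ' => ?_) f hS y hπ
    rw [LinearEquiv.coe_coe, coe_piFourierEquivSB_symm]
    simp only [neg_add]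
    rw [piFourierSB_add_eq_of_support_subset μ₁ hm hf₁ (-η) (neg_mem_piPrimePowBall hπ')]
  have h0 : ℱ f = 0 := Subtype.ext hg
  have hinv : sumEndSB K e (piFourierEquivSB μ₁ hψ hm).toLinearMap LinearMap.id ∘ₗ ℱ = LinearMap.id := by
    rw [hℱ, ← sumEndSB_comp, ← sumEndSB_id K e]
    congr 1
    exact LinearMap.ext fun x => (piFourierEquivSB μ₁ hψ hm).apply_symm_apply x
  have := LinearMap.congr_fun hinv f
  rw [LinearMap.comp_apply, h0, map_zero, LinearMap.id_apply] at this
  exact this.symm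

end PartialFourier

/-! ## §6 The lattice hypothesis (H) for `Q₂ = c · N`, `N` a quadratic map with a unit value -/

section Lattice

variable {K : Type*} [Field K] [ValuativeRel K] [TopologicalSpace K] [IsNonarchimedeanLocalField K]
  {ι₁ : Type*}

/-- the parallelogram law of a quadratic map: `N(x + y) + N(x − y) = 2·(N x + N y)`. [cite: WeilBNT1967, Chap. II §5] -/
theorem _root_.QuadraticMap.map_add_add_map_sub_eq_two_mul {R M : Type*} [CommRing R] [AddCommGroup M] [Module R M]
    (N : QuadraticMap R M R) (x y : M) : N (x + y) + N (x - y) = 2 * (N x + N y) := by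
  rw [QuadraticMap.map_add N x y, sub_eq_add_neg, QuadraticMap.map_add N x (-y), QuadraticMap.map_neg,
    QuadraticMap.polar_neg_right]
  ring

/-- scaling a vector of `𝒪^{ι₁}` by `t` with `|t| = q^{−k}` lands in `(𝔭^k)^{ι₁}`. [cite: WeilBNT1967, Chap. II §2] -/
theorem smul_mem_piPrimePowBall_of_normAbs_eq {t : K} {k : ℤ} (ht : normAbs K t = (residueFieldCard K : NNReal)⁻¹ ^ k)
    {e₀ : ι₁ → K} (he₀ : e₀ ∈ piPrimePowBall K ι₁ 0) : t • e₀ ∈ piPrimePowBall K ι₁ k := by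
  rw [mem_piPrimePowBall_iff] at he₀ ⊢
  intro i
  rw [Pi.smul_apply, smul_eq_mul, mul_mem_primePowBall_iff ht]
  simpa using he₀ i

/-- **THE LATTICE HYPOTHESIS (H) from a unit value.**  `N` a quadratic map on `K^{ι₁}` taking a UNIT value at some
`e₀ ∈ 𝒪^{ι₁}`, `c` with `|c| = q^{n}` (`c ∼ ϖ^{−n}`), `|2| = 1`, and the parity relation `n + 2a = m + 1`; then
`Q₂ := c · N` is nowhere `𝔭^m`-constant along `(𝔭^{m−a})^{ι₁}`: if `Q₂(η₀ + π) − Q₂(η₀) ∈ 𝔭^m` for `π` AND `−π` then (parallelogram law)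
`2 c N(π) ∈ 𝔭^m`, false at `π = t e₀`, `|t| = q^{a−m}` (value of absolute size `q^{n + 2(m−a)·(−1)…} = q^{1−m}·q⁰ > q^{−m}`).
No anisotropy is used. [cite: WeilBNT1967, Chap. II §5, Prop. 12] -/
theorem exists_mem_piPrimePowBall_mul_quadraticMap_add_sub_notMem (N : QuadraticMap K (ι₁ → K) K)
    {e₀ : ι₁ → K} (he₀ : e₀ ∈ piPrimePowBall K ι₁ 0) (hNe₀ : normAbs K (N e₀) = 1)
    {c : K} {n : ℤ} (hc : normAbs K c = (residueFieldCard K : NNReal)⁻¹ ^ (-n))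
    (h2 : normAbs K (2 : K) = 1) {m a : ℤ} (hodd : n + 2 * a = m + 1) (η₀ : ι₁ → K) :
    ∃ π ∈ piPrimePowBall K ι₁ (m - a), c * N (η₀ + π) - c * N η₀ ∉ primePowBall K m := by
  -- a scalar `t` of absolute value `q^{a−m}` (`= (q⁻¹)^{m−a}`)
  obtain ⟨t, -, ht⟩ := exists_normAbs_eq_inv_zpow_of_int (F := K) (m - a)
  set π : ι₁ → K := t • e₀ with hπ
  have hπmem : π ∈ piPrimePowBall K ι₁ (m - a) := smul_mem_piPrimePowBall_of_normAbs_eq ht he₀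
  by_contra hall
  push Not at hall
  have hp := hall π hπmem
  have hn := hall (-π) (neg_mem_piPrimePowBall hπmem)
  -- add the two congruences: `c (N(η₀+π) + N(η₀−π) − 2 N η₀) = 2 c N π ∈ 𝔭^m`
  have hsum := add_mem_primePowBall hp hn
  have hid : c * N (η₀ + π) - c * N η₀ + (c * N (η₀ + -π) - c * N η₀) = 2 * c * N π := by
    rw [← sub_eq_add_neg]
    have := N.map_add_add_map_sub_eq_two_mul η₀ π
    linear_combination c * this
  rw [hid] at hsum
  -- but `|2 c N π| = |c| |t|² |N e₀| = q^{n} q^{2(a−m)} = q^{−(m−1)}`: not in `𝔭^m`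
  have hNπ : N π = t * t * N e₀ := by
    rw [hπ, QuadraticMap.map_smul, smul_eq_mul]
  rw [mem_primePowBall_iff] at hsum
  rw [hNπ, map_mul, map_mul, map_mul, map_mul, h2, hc, ht, hNe₀, one_mul, mul_one, ← zpow_add₀ inv_residueFieldCard_pos.ne',
    ← zpow_add₀ inv_residueFieldCard_pos.ne'] at hsum
  have hexp : -n + (m - a + (m - a)) = m - 1 := by omega
  rw [hexp] at hsum
  -- `(q⁻¹)^{m−1} ≤ (q⁻¹)^m` is false since `q⁻¹ < 1`
  have hlt : ((residueFieldCard K : NNReal)⁻¹) ^ m < ((residueFieldCard K : NNReal)⁻¹) ^ (m - 1) :=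
    zpow_lt_zpow_right_of_lt_one₀ inv_residueFieldCard_pos inv_residueFieldCard_lt_one (by omega)
  exact absurd hsum (not_le.mpr hlt)

end Lattice

end Literature.RepresentationTheory.HeisenbergGroup
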